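import Summits.CriticalPhenomena.PercolationContinuityZ3.Theorems.PercNearOneGluingNoHeavyQuantTwoPointHubSliverLow
import HarnessLib

/-!
# QUANT lane R8, FAR on trees: the thinned hub as an extra blob (K4 in both cells) and the VERTEX STEP —
# (B-4) of the profile conjecture for every gate `G` of the hub

builds on p205010 (kernel theorem, internal audit signed; external expert review pending)

Support file (`--supports stmt-CriticalPhenomena-4575`), QUANT lane seat prim-quant-census-2 (gen 47); memos
`run/shared/lean/prim/quant/prim-quant-census-2-g46/TP-REDUCTION-SURPLUS-FAR.md` (R1) and `…/prim-quant-census-2-g47/B4-CANTELLI-G47.md` §4.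
Theorems only; no sorries; standard axioms.

**Setting.** `W = Σ_k a_k ζ_k` on a finite type `κ` (integer sizes `a k`, gates `p k`, least reliable blob `y₀`, `g = p y₀`), tails
`P(t ≤ W)`, `P(t ≤ M + W)` written as filtered sums of the product weights (vocabulary of `…QuantTwoPointHubSliver`).

* `Quant.IndepBlob.sum_finset_option` — splitting a sum over the configurations of `Option κ` at the coordinate `none`
  (`s ↦ eraseNone s`, inverses `insertNone` / `map some`).
* `Quant.IndepBlob.hubMixture_far` — **block-star FAR with ONE EXTRA BLOB of arbitrary gate** ("K4", the thinned hub): for a hub of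
  size `M` and gate `π ∈ [0,1]` independent of `W` and `2(s − 1) < Mπ + EW`,
  `min(π, g) ≤ π·P(s ≤ M + W) + (1 − π)·P(s ≤ W)` — in BOTH cells (`π ≤ g`: the hub is the least reliable blob; `g < π`: `y₀` is), by
  `far_indepBlob_min` on `Option κ` and the splitting lemma.  (`far_indepBlob`'s mixture form needs the distinguished gate to be the least one.)
* `Quant.IndepBlob.twoPointHub_vertex` — **(B-4) of PROFILE-PROOF-G10 §11 for every `G`** (census-2 gen 46, R1): integers `1 ≤ k`,
  `m + 1 ≤ s`, reals `0 ≤ G ≤ 1`, `μ < m` with `γ := Gμ ∈ (2k, 2k+1)` and `2s − 2 < γ + EW`; then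
  `min(γ/m, g) ≤ (1 − G)·P(s ≤ W) + G·((m−μ)/(m−k))·P(s ≤ k + W) + G·((μ−k)/(m−k))·P(s ≤ m + W)`.
  Proof: the hub law on `{0, k, m}` (mean `γ`) is the mixture `w·{k,m} + (1−w)·{0,m}` of the two mean-`γ` two-point laws,
  `w = G(m−μ)/(m−γ) ∈ [0,1]`; the `{k,m}` term is `twoPointHub_sliver` (i = k, c = m − k, y = s − k, d = γ − 2k), the `{0,m}` term is
  `hubMixture_far` with `π = γ/m`.
With this file, census-1 gen 10's proof of `Quant.HubBlocksProfileIneq` (PROFILE-PROOF-G10 §2–§5, §11) has all its blob-sum inputs in the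
kernel (FAR `far_indepBlob_min`, HALF-ROW `halfRow`, K4 `hubMixture_far`, (B-4) `twoPointHub_vertex`); the §2–§5/§11 assembly itself remains
to be typed. [this work]
-/

namespace Summit.CriticalPhenomena.PercolationContinuityZ3.Theorems

namespace Quant

namespace IndepBlob

open Finset

variable {κ : Type*} [Fintype κ] [DecidableEq κ]

/-! ### 1. Configurations of `Option κ` -/

/-- Splitting a sum over the configurations of `Option κ` according to whether `none` is open:
`∑_{s ⊆ Option κ} F s = ∑_{T ⊆ κ} F (insertNone T) + ∑_{T ⊆ κ} F (T.map some)`. [folklore] -/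
theorem sum_finset_option (F : Finset (Option κ) → ℝ) :
    ∑ s : Finset (Option κ), F s =
      ∑ T : Finset κ, F (insertNone T) + ∑ T : Finset κ, F (T.map Function.Embedding.some) := by
  rw [← Finset.sum_filter_add_sum_filter_not (Finset.univ : Finset (Finset (Option κ)))
    (fun s => none ∈ s) F]
  congr 1
  · refine Finset.sum_nbij' (fun s => eraseNone s) (fun T => insertNone T) ?_ ?_ ?_ ?_ ?_
    · intro s _; exact Finset.mem_univ _
    · intro T _
      rw [Finset.mem_filter]
      exact ⟨Finset.mem_univ _, Finset.none_mem_insertNone⟩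
    · intro s hs
      rw [Finset.mem_filter] at hs
      rw [Finset.insertNone_eraseNone, Finset.insert_eq_of_mem hs.2]
    · intro T _
      exact Finset.eraseNone_insertNone T
    · intro s hs
      rw [Finset.mem_filter] at hs
      rw [Finset.insertNone_eraseNone, Finset.insert_eq_of_mem hs.2]
  · refine Finset.sum_nbij' (fun s => eraseNone s) (fun T => T.map Function.Embedding.some) ?_ ?_ ?_ ?_ ?_
    · intro s _; exact Finset.mem_univ _
    · intro T _
      rw [Finset.mem_filter]
      refine ⟨Finset.mem_univ _, ?_⟩
      rw [Finset.mem_map]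
      rintro ⟨k, -, hk⟩
      exact Option.some_ne_none k hk
    · intro s hs
      rw [Finset.mem_filter] at hs
      rw [Finset.map_some_eraseNone, Finset.erase_eq_of_notMem hs.2]
    · intro T _
      exact Finset.eraseNone_map_some T
    · intro s hs
      rw [Finset.mem_filter] at hs
      rw [Finset.map_some_eraseNone, Finset.erase_eq_of_notMem hs.2]

/-- The product weight on `Option κ` with hub gate `π` at `none`: on `insertNone T` it is `π · w(T)`. [folklore] -/
theorem bernoulliWeight_insertNone (p : κ → ℝ) (π : ℝ) (T : Finset κ) :
    (∏ o : Option κ, if o ∈ insertNone T then (Option.elim o π p) else 1 - Option.elim o π p) =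
      π * ∏ k, (if k ∈ T then p k else 1 - p k) := by
  rw [Fintype.prod_option]
  congr 1
  · rw [if_pos Finset.none_mem_insertNone]; rfl
  · refine Finset.prod_congr rfl fun k _ => ?_
    simp only [Finset.some_mem_insertNone, Option.elim]

/-- The product weight on `Option κ` with hub gate `π` at `none`: on `T.map some` it is `(1 − π) · w(T)`. [folklore] -/
theorem bernoulliWeight_map_some (p : κ → ℝ) (π : ℝ) (T : Finset κ) :
    (∏ o : Option κ, if o ∈ T.map Function.Embedding.some then (Option.elim o π p) else 1 - Option.elim o π p) =
      (1 - π) * ∏ k, (if k ∈ T then p k else 1 - p k) := by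
  rw [Fintype.prod_option]
  congr 1
  · have : (none : Option κ) ∉ T.map Function.Embedding.some := by
      rw [Finset.mem_map]
      rintro ⟨k, -, hk⟩
      exact Option.some_ne_none k hk
    rw [if_neg this]; rfl
  · refine Finset.prod_congr rfl fun k _ => ?_
    have : (some k ∈ T.map Function.Embedding.some) ↔ k ∈ T := by
      rw [← Function.Embedding.some_apply, Finset.mem_map' Function.Embedding.some]
    simp only [this, Option.elim]

/-! ### 2. K4: block-star FAR with the (thinned) hub as an extra blob, in both cells -/

/-- **Block-star FAR with one extra blob of arbitrary gate** (the thinned hub, "K4").  Gates `0 ≤ p k ≤ 1` with least reliable blob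
`y₀`; integer sizes `a k`; a hub of size `M` and gate `0 ≤ π ≤ 1`, independent of the blocks; a level `s` with `2(s − 1) < Mπ + EW`.  Then
`min(π, p y₀) ≤ π·P(s ≤ M + W) + (1 − π)·P(s ≤ W)`. [this work] -/
theorem hubMixture_far (p : κ → ℝ) (a : κ → ℕ) (hp0 : ∀ k, 0 ≤ p k) (hp1 : ∀ k, p k ≤ 1)
    (y₀ : κ) (hy₀ : ∀ k, p y₀ ≤ p k) (π : ℝ) (hπ0 : 0 ≤ π) (hπ1 : π ≤ 1) (M s : ℕ)
    (H : 2 * ((s : ℝ) - 1) < (M : ℝ) * π + ∑ k, (a k : ℝ) * p k) :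
    min π (p y₀) ≤
      π * ∑ T ∈ (Finset.univ : Finset (Finset κ)).filter (fun T => s ≤ M + ∑ k ∈ T, a k), (∏ k, if k ∈ T then p k else 1 - p k) +
        (1 - π) * ∑ T ∈ (Finset.univ : Finset (Finset κ)).filter (fun T => s ≤ ∑ k ∈ T, a k), (∏ k, if k ∈ T then p k else 1 - p k) := by
  -- the joint system on `Option κ`
  set p' : Option κ → ℝ := fun o => Option.elim o π p with hp'
  set a' : Option κ → ℝ := fun o => Option.elim o (M : ℝ) (fun k => (a k : ℝ)) with ha'
  have hp'0 : ∀ o, 0 ≤ p' o := by rintro (_ | k) <;> simp [hp', hπ0, hp0]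
  have hp'1 : ∀ o, p' o ≤ 1 := by rintro (_ | k) <;> simp [hp', hπ1, hp1]
  have ha'0 : ∀ o, 0 ≤ a' o := by rintro (_ | k) <;> simp [ha']
  have hw0 : ∀ T : Finset κ, 0 ≤ (∏ k, if k ∈ T then p k else 1 - p k) := bernoulliWeight_nonneg hp0 hp1
  -- its mean
  have hmean : ∑ o, a' o * p' o = (M : ℝ) * π + ∑ k, (a k : ℝ) * p k := by
    rw [Fintype.sum_option]; rfl
  have hj : 2 * ((s : ℝ) - 1) < ∑ o, a' o * p' o := by rw [hmean]; exact H
  -- the least reliable coordinate of the joint system, by cell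
  have key : ∃ o₀ : Option κ, min π (p y₀) ≤ p' o₀ ∧ ∀ o, p' o₀ ≤ p' o := by
    by_cases hcell : π ≤ p y₀
    · refine ⟨none, by simp [hp'], ?_⟩
      rintro (_ | k)
      · exact le_rfl
      · show π ≤ p k; exact hcell.trans (hy₀ k)
    · push Not at hcell
      refine ⟨some y₀, by simp [hp'], ?_⟩
      rintro (_ | k)
      · show p y₀ ≤ π; exact hcell.le
      · exact hy₀ k
  obtain ⟨o₀, ho₀, hmin⟩ := key
  have hfar := far_indepBlob_min p' a' hp'0 hp'1 ha'0 o₀ hmin ((s : ℝ) - 1) hj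
  -- split the light sum of the joint system at `none`
  have hsplit : ∑ s' ∈ (Finset.univ : Finset (Finset (Option κ))).filter (fun s' => ∑ o ∈ s', a' o ≤ (s : ℝ) - 1),
      (∏ o, if o ∈ s' then p' o else 1 - p' o) =
      π * ∑ T ∈ (Finset.univ : Finset (Finset κ)).filter (fun T => (M : ℝ) + ∑ k ∈ T, (a k : ℝ) ≤ (s : ℝ) - 1),
          (∏ k, if k ∈ T then p k else 1 - p k) +
        (1 - π) * ∑ T ∈ (Finset.univ : Finset (Finset κ)).filter (fun T => ∑ k ∈ T, (a k : ℝ) ≤ (s : ℝ) - 1),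
          (∏ k, if k ∈ T then p k else 1 - p k) := by
    rw [Finset.sum_filter, sum_finset_option, Finset.sum_filter, Finset.sum_filter, Finset.mul_sum, Finset.mul_sum]
    congr 1
    · refine Finset.sum_congr rfl fun T _ => ?_
      have hcount : ∑ o ∈ insertNone T, a' o = (M : ℝ) + ∑ k ∈ T, (a k : ℝ) := by
        rw [Finset.sum_insertNone]; rfl
      have hwt : (∏ o, if o ∈ insertNone T then p' o else 1 - p' o) = π * ∏ k, (if k ∈ T then p k else 1 - p k) :=
        bernoulliWeight_insertNone p π T
      rw [hcount, hwt]
      split_ifs <;> simp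
    · refine Finset.sum_congr rfl fun T _ => ?_
      have hcount : ∑ o ∈ T.map Function.Embedding.some, a' o = ∑ k ∈ T, (a k : ℝ) := by
        rw [Finset.sum_map]; rfl
      have hwt : (∏ o, if o ∈ T.map Function.Embedding.some then p' o else 1 - p' o) =
          (1 - π) * ∏ k, (if k ∈ T then p k else 1 - p k) := bernoulliWeight_map_some p π T
      rw [hcount, hwt]
      split_ifs <;> simp
  rw [hsplit] at hfar
  -- identify the two light events with the complements of the integer tails
  set PM : ℝ := ∑ T ∈ (Finset.univ : Finset (Finset κ)).filter (fun T => s ≤ M + ∑ k ∈ T, a k),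
      (∏ k, if k ∈ T then p k else 1 - p k) with hPM
  set P0 : ℝ := ∑ T ∈ (Finset.univ : Finset (Finset κ)).filter (fun T => s ≤ ∑ k ∈ T, a k),
      (∏ k, if k ∈ T then p k else 1 - p k) with hP0
  have hLM : ∑ T ∈ (Finset.univ : Finset (Finset κ)).filter (fun T => (M : ℝ) + ∑ k ∈ T, (a k : ℝ) ≤ (s : ℝ) - 1),
      (∏ k, if k ∈ T then p k else 1 - p k) = 1 - PM := by
    have hcompl := Finset.sum_filter_add_sum_filter_not (Finset.univ : Finset (Finset κ))
      (fun T => s ≤ M + ∑ k ∈ T, a k) (fun T => (∏ k, if k ∈ T then p k else 1 - p k))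
    rw [sum_bernoulliWeight p] at hcompl
    have he : (Finset.univ : Finset (Finset κ)).filter (fun T => ¬ (s ≤ M + ∑ k ∈ T, a k)) =
        (Finset.univ : Finset (Finset κ)).filter (fun T => (M : ℝ) + ∑ k ∈ T, (a k : ℝ) ≤ (s : ℝ) - 1) := by
      refine Finset.filter_congr fun T _ => ?_
      rw [not_le]
      constructor
      · intro h
        have h' : M + ∑ k ∈ T, a k + 1 ≤ s := by omega
        have : ((M + ∑ k ∈ T, a k + 1 : ℕ) : ℝ) ≤ ((s : ℕ) : ℝ) := by exact_mod_cast h'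
        push_cast at this
        linarith
      · intro h
        have h' : ((M + ∑ k ∈ T, a k + 1 : ℕ) : ℝ) ≤ ((s : ℕ) : ℝ) := by push_cast; linarith
        have h'' : M + ∑ k ∈ T, a k + 1 ≤ s := by exact_mod_cast h'
        omega
    rw [he] at hcompl
    rw [hPM]
    linarith
  have hL0 : ∑ T ∈ (Finset.univ : Finset (Finset κ)).filter (fun T => ∑ k ∈ T, (a k : ℝ) ≤ (s : ℝ) - 1),
      (∏ k, if k ∈ T then p k else 1 - p k) = 1 - P0 := by
    have hcompl := Finset.sum_filter_add_sum_filter_not (Finset.univ : Finset (Finset κ))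
      (fun T => s ≤ ∑ k ∈ T, a k) (fun T => (∏ k, if k ∈ T then p k else 1 - p k))
    rw [sum_bernoulliWeight p] at hcompl
    have he : (Finset.univ : Finset (Finset κ)).filter (fun T => ¬ (s ≤ ∑ k ∈ T, a k)) =
        (Finset.univ : Finset (Finset κ)).filter (fun T => ∑ k ∈ T, (a k : ℝ) ≤ (s : ℝ) - 1) := by
      refine Finset.filter_congr fun T _ => ?_
      rw [not_le]
      constructor
      · intro h
        have h' : ∑ k ∈ T, a k + 1 ≤ s := by omega
        have : ((∑ k ∈ T, a k + 1 : ℕ) : ℝ) ≤ ((s : ℕ) : ℝ) := by exact_mod_cast h'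
        push_cast at this
        linarith
      · intro h
        have h' : ((∑ k ∈ T, a k + 1 : ℕ) : ℝ) ≤ ((s : ℕ) : ℝ) := by push_cast; linarith
        have h'' : ∑ k ∈ T, a k + 1 ≤ s := by exact_mod_cast h'
        omega
    rw [he] at hcompl
    rw [hP0]
    linarith
  rw [hLM, hL0] at hfar
  -- `π (1 − PM) + (1 − π)(1 − P0) ≤ 1 − p' o₀` gives `p' o₀ ≤ π PM + (1 − π) P0`
  have : p' o₀ ≤ π * PM + (1 - π) * P0 := by linarith
  exact ho₀.trans this

/-! ### 3. The vertex step: (B-4) for every hub gate `G` -/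

/-- **(B-4) of the profile conjecture, every `G`** (the unpaired term `e_k(U_m) ≥ 0` of PROFILE-PROOF-G10 §11).  Gates `0 ≤ p k ≤ 1`
with least reliable blob `y₀`; integer sizes `a k ≥ 1`; integers `1 ≤ k`, `m + 1 ≤ s`; reals `0 ≤ G ≤ 1` and `μ < m` with
`2k < Gμ < 2k + 1`; and `2s − 2 < Gμ + EW`.  Then, with `α = (m − μ)/(m − k)`, `β = (μ − k)/(m − k)`,
`min(Gμ/m, p y₀) ≤ (1 − G)·P(s ≤ W) + G·α·P(s ≤ k + W) + G·β·P(s ≤ m + W)`: the hub law on `{0, k, m}` is a mixture of the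
mean-`Gμ` laws on `{k, m}` (`twoPointHub_sliver`) and `{0, m}` (`hubMixture_far`). [this work] -/
theorem twoPointHub_vertex (p : κ → ℝ) (a : κ → ℕ) (hp0 : ∀ k, 0 ≤ p k) (hp1 : ∀ k, p k ≤ 1) (ha : ∀ k, 1 ≤ a k)
    (y₀ : κ) (hy₀ : ∀ k, p y₀ ≤ p k) (k m s : ℕ) (G μ : ℝ) (hk : 1 ≤ k) (hms : m + 1 ≤ s)
    (hG0 : 0 ≤ G) (hG1 : G ≤ 1) (hμm : μ < m) (h2k : 2 * (k : ℝ) < G * μ) (h2k1 : G * μ < 2 * (k : ℝ) + 1)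
    (H : 2 * (s : ℝ) - 2 < G * μ + ∑ i, (a i : ℝ) * p i) :
    min (G * μ / m) (p y₀) ≤
      (1 - G) * ∑ T ∈ (Finset.univ : Finset (Finset κ)).filter (fun T => s ≤ ∑ i ∈ T, a i), (∏ i, if i ∈ T then p i else 1 - p i) +
        G * (((m : ℝ) - μ) / ((m : ℝ) - k)) *
          ∑ T ∈ (Finset.univ : Finset (Finset κ)).filter (fun T => s ≤ k + ∑ i ∈ T, a i), (∏ i, if i ∈ T then p i else 1 - p i) +
        G * ((μ - k) / ((m : ℝ) - k)) *
          ∑ T ∈ (Finset.univ : Finset (Finset κ)).filter (fun T => s ≤ m + ∑ i ∈ T, a i), (∏ i, if i ∈ T then p i else 1 - p i) := by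
  set γ : ℝ := G * μ with hγ
  set Ps : ℝ := ∑ T ∈ (Finset.univ : Finset (Finset κ)).filter (fun T => s ≤ ∑ i ∈ T, a i),
      (∏ i, if i ∈ T then p i else 1 - p i) with hPs
  set Pk : ℝ := ∑ T ∈ (Finset.univ : Finset (Finset κ)).filter (fun T => s ≤ k + ∑ i ∈ T, a i),
      (∏ i, if i ∈ T then p i else 1 - p i) with hPk
  set Pm : ℝ := ∑ T ∈ (Finset.univ : Finset (Finset κ)).filter (fun T => s ≤ m + ∑ i ∈ T, a i),
      (∏ i, if i ∈ T then p i else 1 - p i) with hPm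
  have hw0 : ∀ T : Finset κ, 0 ≤ (∏ i, if i ∈ T then p i else 1 - p i) := bernoulliWeight_nonneg hp0 hp1
  -- numerics: `0 < 2k < γ ≤ μ < m`, so `m ≥ 2k + 1`
  have hk1 : (1 : ℝ) ≤ k := by exact_mod_cast hk
  have hγpos : 0 < γ := by rw [hγ]; linarith
  have hγμ : γ ≤ μ := by
    rw [hγ]
    have hμ0 : 0 < μ := by
      by_contra hμ
      push Not at hμ
      have : G * μ ≤ 0 := mul_nonpos_of_nonneg_of_nonpos hG0 hμ
      linarith
    nlinarith
  have hγm : γ < m := lt_of_le_of_lt hγμ hμm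
  have hkm : 2 * k + 1 ≤ m := by
    have : 2 * (k : ℝ) < m := by linarith
    have : ((2 * k : ℕ) : ℝ) < ((m : ℕ) : ℝ) := by push_cast; linarith
    exact_mod_cast this
  have hkm' : k ≤ m := by omega
  have hmk0 : (0 : ℝ) < (m : ℝ) - k := by
    have : ((2 * k + 1 : ℕ) : ℝ) ≤ ((m : ℕ) : ℝ) := by exact_mod_cast hkm
    push_cast at this
    linarith
  have hm0 : (0 : ℝ) < m := by linarith
  have hmγ : 0 < (m : ℝ) - γ := by linarith
  -- the `{k, m}` vertex: TP1-sliver with `i = k`, `c = m − k`, `y = s − k`, `d = γ − 2k`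
  have hcast_c : ((m - k : ℕ) : ℝ) = (m : ℝ) - k := by rw [Nat.cast_sub hkm']
  have hcast_y : ((s - k : ℕ) : ℝ) = (s : ℝ) - k := by rw [Nat.cast_sub (by omega)]
  have hTP := twoPointHub_sliver p a hp0 hp1 ha y₀ hy₀ k (m - k) (s - k) (γ - 2 * k) hk (by omega) (by omega)
    (by linarith) (by linarith) (by rw [hcast_c]; linarith) (by rw [hcast_y]; linarith)
  -- rewrite its data: `ρ = γ/m`, `λ = (γ − k)/(m − k)`, levels `s − k` and `s − k − (m − k) = s − m`
  have hρ : (2 * (k : ℝ) + (γ - 2 * k)) / ((k : ℝ) + ((m - k : ℕ) : ℝ)) = γ / m := by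
    rw [hcast_c]; congr 1 <;> ring
  have hfk : (Finset.univ : Finset (Finset κ)).filter (fun T => s - k ≤ ∑ i ∈ T, a i) =
      (Finset.univ : Finset (Finset κ)).filter (fun T => s ≤ k + ∑ i ∈ T, a i) := by
    refine Finset.filter_congr fun T _ => ?_
    omega
  have hfm : (Finset.univ : Finset (Finset κ)).filter (fun T => s - k - (m - k) ≤ ∑ i ∈ T, a i) =
      (Finset.univ : Finset (Finset κ)).filter (fun T => s ≤ m + ∑ i ∈ T, a i) := by
    refine Finset.filter_congr fun T _ => ?_
    omega
  rw [hρ, hfk, hfm, hcast_c] at hTP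
  -- the `{0, m}` vertex: K4 with `π = γ/m`
  have hπ0 : 0 ≤ γ / m := by positivity
  have hπ1 : γ / m ≤ 1 := by rw [div_le_one hm0]; linarith
  have hK4 := hubMixture_far p a hp0 hp1 y₀ hy₀ (γ / m) hπ0 hπ1 m s (by
    have e : (m : ℝ) * (γ / m) = γ := by field_simp
    rw [e]; linarith)
  -- the mixture weights
  set lam : ℝ := ((k : ℝ) + (γ - 2 * k)) / ((m : ℝ) - k) with hlam
  set w : ℝ := G * ((m : ℝ) - μ) / ((m : ℝ) - γ) with hw
  have hw0' : 0 ≤ w := by rw [hw]; exact div_nonneg (mul_nonneg hG0 (by linarith)) hmγ.le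
  have hw1 : w ≤ 1 := by
    rw [hw, div_le_one hmγ, hγ]
    nlinarith
  have hmkne : (m : ℝ) - k ≠ 0 := hmk0.ne'
  have hmγne : (m : ℝ) - γ ≠ 0 := hmγ.ne'
  have hmne : (m : ℝ) ≠ 0 := hm0.ne'
  have hmγne' : (m : ℝ) - G * μ ≠ 0 := fun h0 => hmγne (by rw [hγ]; exact h0)
  -- the mixture identity (coefficient by coefficient; `γ = Gμ`)
  have e : (1 - G) * Ps + G * (((m : ℝ) - μ) / ((m : ℝ) - k)) * Pk + G * ((μ - k) / ((m : ℝ) - k)) * Pm =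
      w * ((1 - lam) * Pk + lam * Pm) + (1 - w) * ((γ / m) * Pm + (1 - γ / m) * Ps) := by
    rw [hw, hlam, hγ]
    field_simp
    ring
  have hθ : min (γ / m) (p y₀) = w * min (γ / m) (p y₀) + (1 - w) * min (γ / m) (p y₀) := by ring
  show min (γ / m) (p y₀) ≤ (1 - G) * Ps + G * (((m : ℝ) - μ) / ((m : ℝ) - k)) * Pk + G * ((μ - k) / ((m : ℝ) - k)) * Pm
  rw [e, hθ]
  exact add_le_add (mul_le_mul_of_nonneg_left hTP hw0') (mul_le_mul_of_nonneg_left hK4 (by linarith))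

end IndepBlob

end Quant

end Summit.CriticalPhenomena.PercolationContinuityZ3.Theorems
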